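import Mathlib.Tactic.Ring
import Mathlib.Tactic.Linarith
import Mathlib.Tactic.Positivity
import Mathlib.Tactic.LinearCombination
import Mathlib.Data.Real.Basic
import Summits.HodgeConjecture.HodgeConjecture.Theorems.WeilClassTestFormatFiveThreeQ2
import HarnessLib

/-!
# Conjecture N (hodge-weil ladder, GAPS G51b), format (5,3), real charges: THE PATTERNS (1,1,1) AND (4,4,4) BY AN EXACT CERTIFICATE

Prover 2, generation 17 (note `run/shared/lean/b2b/hodge-weil/b2b-hweil-pv2-g17/REAL-N53-G17.md`, ADDENDUM 1). On the sorted charge pattern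
(1,1,1) — `u₁ ≤ v₁ ≤ v₂ ≤ v₃ ≤ u₂ ≤ u₃ ≤ u₄ ≤ u₅` (weak inequalities; one E-charge below the F-charges, four above) — centring and P4 force
`Q₄ ≥ 0` (`Q4_nonneg_111`). PROOF = an exact Handelman-type certificate found by linear programming (`code/pv2-g17/handelman.py`,
`handelman_exact.py`, `gen_cert111.py`): in the gap variables `d₁ = v₁−u₁, d₂ = v₂−v₁, d₃ = v₃−v₂, d₄ = u₂−v₃, d₅ = u₃−u₂, d₆ = u₄−u₃, d₇ = u₅−u₄`
(all `≥ 0`), with the base charge eliminated by centring, `Q₄ = Σ_α c_α d^α + (2d₁ − 6d₃ − 10d₄ − 7d₅ − 4d₆ − 2d₇)·P4` with 86 POSITIVE rational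
coefficients `c_α` on monomials of degree 4 and all other coefficients zero (`ring` checks the identity after eliminating `v₃` by centring, `positivity`
the sign). Hence (pv2-g15's `conjectureN_53_of_Q4_nonneg`) `Q₂ + λQ₄ ≥ 0` for every `λ ≥ 0` on (1,1,1) (`Glam_nonneg_111`) and, by the reflection
`u ↦ −u`, on (4,4,4) (`Glam_nonneg_444`). (This is the algebraic substitute for the Rolle count 'a line meets the quintic `∏(t−v_g)(t²−S/2)` at most
three times in a root gap' in this pattern; cf. the companion files `…LineQuintic`, `…EmptyPatterns`, `…K0Signs`.)
Pure algebra; nothing here is a case of HC, a rung or a door edge; no statement of Markman's papers is used. New cell result ⇒ Summits/.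
-/

set_option linter.dupNamespace false

open Summit.HodgeConjecture.HodgeConjecture.WeilClassTestFormatFiveThreeQ2

namespace Summit.HodgeConjecture.HodgeConjecture.WeilClassTestFormatFiveThreePattern111

set_option maxHeartbeats 800000 in
/-- `Q₄ ≥ 0` ON THE SORTED PATTERN (1,1,1) (weak inequalities), given centring and P4 — exact degree-4 certificate with 86 positive terms. -/
theorem Q4_nonneg_111 (u₁ u₂ u₃ u₄ u₅ v₁ v₂ v₃ : ℝ)
    (hC : u₁ + u₂ + u₃ + u₄ + u₅ = v₁ + v₂ + v₃)
    (hP4 : (u₁ ^ 3 + u₂ ^ 3 + u₃ ^ 3 + u₄ ^ 3 + u₅ ^ 3) - (v₁ ^ 3 + v₂ ^ 3 + v₃ ^ 3) = 0)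
    (h₀ : u₁ ≤ v₁) (h₁ : v₁ ≤ v₂) (h₂ : v₂ ≤ v₃) (h₃ : v₃ ≤ u₂) (h₄ : u₂ ≤ u₃) (h₅ : u₃ ≤ u₄) (h₆ : u₄ ≤ u₅) :
    0 ≤ 3 * ((u₁ ^ 4 + u₂ ^ 4 + u₃ ^ 4 + u₄ ^ 4 + u₅ ^ 4) - (v₁ ^ 4 + v₂ ^ 4 + v₃ ^ 4)) - (3 / 2) * ((u₁ ^ 2 + u₂ ^ 2 + u₃ ^ 2 + u₄ ^ 2 + u₅ ^ 2) - (v₁ ^ 2 + v₂ ^ 2 + v₃ ^ 2)) ^ 2 := by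
  have e₀ : 0 ≤ v₁ - u₁ := sub_nonneg.mpr h₀
  have e₁ : 0 ≤ v₂ - v₁ := sub_nonneg.mpr h₁
  have e₂ : 0 ≤ v₃ - v₂ := sub_nonneg.mpr h₂
  have e₃ : 0 ≤ u₂ - v₃ := sub_nonneg.mpr h₃
  have e₄ : 0 ≤ u₃ - u₂ := sub_nonneg.mpr h₄
  have e₅ : 0 ≤ u₄ - u₃ := sub_nonneg.mpr h₅
  have e₆ : 0 ≤ u₅ - u₄ := sub_nonneg.mpr h₆
  have key : 3 * ((u₁ ^ 4 + u₂ ^ 4 + u₃ ^ 4 + u₄ ^ 4 + u₅ ^ 4) - (v₁ ^ 4 + v₂ ^ 4 + v₃ ^ 4)) - (3 / 2) * ((u₁ ^ 2 + u₂ ^ 2 + u₃ ^ 2 + u₄ ^ 2 + u₅ ^ 2) - (v₁ ^ 2 + v₂ ^ 2 + v₃ ^ 2)) ^ 2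
      = ((12) * (v₁ - u₁) * (v₂ - v₁) * (v₂ - v₁) * (v₂ - v₁) + (36) * (v₁ - u₁) * (v₂ - v₁) * (v₂ - v₁) * (v₃ - v₂) + (42) * (v₁ - u₁) * (v₂ - v₁) * (v₂ - v₁) * (u₂ - v₃) + (33) * (v₁ - u₁) * (v₂ - v₁) * (v₂ - v₁) * (u₃ - u₂) + (24) * (v₁ - u₁) * (v₂ - v₁) * (v₂ - v₁) * (u₄ - u₃) + (12) * (v₁ - u₁) * (v₂ - v₁) * (v₂ - v₁) * (u₅ - u₄) + (36) * (v₁ - u₁) * (v₂ - v₁) * (v₃ - v₂) * (v₃ - v₂) + (78) * (v₁ - u₁) * (v₂ - v₁) * (v₃ - v₂) * (u₂ - v₃) + (63) * (v₁ - u₁) * (v₂ - v₁) * (v₃ - v₂) * (u₃ - u₂) + (48) * (v₁ - u₁) * (v₂ - v₁) * (v₃ - v₂) * (u₄ - u₃) + (24) * (v₁ - u₁) * (v₂ - v₁) * (v₃ - v₂) * (u₅ - u₄) + (48) * (v₁ - u₁) * (v₂ - v₁) * (u₂ - v₃) * (u₂ - v₃) + (78) * (v₁ - u₁) * (v₂ -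 v₁) * (u₂ - v₃) * (u₃ - u₂) + (60) * (v₁ - u₁) * (v₂ - v₁) * (u₂ - v₃) * (u₄ - u₃) + (30) * (v₁ - u₁) * (v₂ - v₁) * (u₂ - v₃) * (u₅ - u₄) + (27) * (v₁ - u₁) * (v₂ - v₁) * (u₃ - u₂) * (u₃ - u₂) + (42) * (v₁ - u₁) * (v₂ - v₁) * (u₃ - u₂) * (u₄ - u₃) + (21) * (v₁ - u₁) * (v₂ - v₁) * (u₃ - u₂) * (u₅ - u₄) + (12) * (v₁ - u₁) * (v₂ - v₁) * (u₄ - u₃) * (u₄ - u₃) + (12) * (v₁ - u₁) * (v₂ - v₁) * (u₄ - u₃) * (u₅ - u₄) + (12) * (v₁ - u₁) * (v₃ - v₂) * (v₃ - v₂) * (v₃ - v₂) + (30) * (v₁ - u₁) * (v₃ - v₂) * (v₃ - v₂) * (u₂ - v₃) + (27) * (v₁ - u₁) * (v₃ - v₂) * (v₃ - v₂) * (u₃ - u₂) + (24) * (v₁ - u₁) * (v₃ - v₂) * (v₃ - v₂) * (u₄ - u₃) + (12) * (v₁ - u₁) * (v₃ - v₂) * (v₃ - v₂) * (u₅ - u₄)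 + (24) * (v₁ - u₁) * (v₃ - v₂) * (u₂ - v₃) * (u₂ - v₃) + (48) * (v₁ - u₁) * (v₃ - v₂) * (u₂ - v₃) * (u₃ - u₂) + (48) * (v₁ - u₁) * (v₃ - v₂) * (u₂ - v₃) * (u₄ - u₃) + (24) * (v₁ - u₁) * (v₃ - v₂) * (u₂ - v₃) * (u₅ - u₄) + (18) * (v₁ - u₁) * (v₃ - v₂) * (u₃ - u₂) * (u₃ - u₂) + (36) * (v₁ - u₁) * (v₃ - v₂) * (u₃ - u₂) * (u₄ - u₃) + (18) * (v₁ - u₁) * (v₃ - v₂) * (u₃ - u₂) * (u₅ - u₄) + (12) * (v₁ - u₁) * (v₃ - v₂) * (u₄ - u₃) * (u₄ - u₃) + (12) * (v₁ - u₁) * (v₃ - v₂) * (u₄ - u₃) * (u₅ - u₄) + (12) * (v₁ - u₁) * (u₂ - v₃) * (u₂ - v₃) * (u₂ - v₃) + (36) * (v₁ - u₁) * (u₂ - v₃) * (u₂ - v₃) * (u₃ - u₂) + (36) * (v₁ - u₁) * (u₂ - v₃) * (u₂ - v₃) * (u₄ - u₃) + (18) * (v₁ - u₁) * (u₂ - v₃)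 * (u₂ - v₃) * (u₅ - u₄) + (27) * (v₁ - u₁) * (u₂ - v₃) * (u₃ - u₂) * (u₃ - u₂) + (54) * (v₁ - u₁) * (u₂ - v₃) * (u₃ - u₂) * (u₄ - u₃) + (27) * (v₁ - u₁) * (u₂ - v₃) * (u₃ - u₂) * (u₅ - u₄) + (18) * (v₁ - u₁) * (u₂ - v₃) * (u₄ - u₃) * (u₄ - u₃) + (18) * (v₁ - u₁) * (u₂ - v₃) * (u₄ - u₃) * (u₅ - u₄) + (3) * (v₁ - u₁) * (u₃ - u₂) * (u₃ - u₂) * (u₃ - u₂) + (12) * (v₁ - u₁) * (u₃ - u₂) * (u₃ - u₂) * (u₄ - u₃) + (6) * (v₁ - u₁) * (u₃ - u₂) * (u₃ - u₂) * (u₅ - u₄) + (9) * (v₁ - u₁) * (u₃ - u₂) * (u₄ - u₃) * (u₄ - u₃) + (9) * (v₁ - u₁) * (u₃ - u₂) * (u₄ - u₃) * (u₅ - u₄) + (6) * (v₃ - v₂) * (v₃ - v₂) * (v₃ - v₂) * (u₂ - v₃) + (3) * (v₃ - v₂) * (v₃ - v₂) * (v₃ - v₂) * (u₃ - u₂) +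 (24) * (v₃ - v₂) * (v₃ - v₂) * (u₂ - v₃) * (u₂ - v₃) + (30) * (v₃ - v₂) * (v₃ - v₂) * (u₂ - v₃) * (u₃ - u₂) + (12) * (v₃ - v₂) * (v₃ - v₂) * (u₂ - v₃) * (u₄ - u₃) + (6) * (v₃ - v₂) * (v₃ - v₂) * (u₂ - v₃) * (u₅ - u₄) + (9) * (v₃ - v₂) * (v₃ - v₂) * (u₃ - u₂) * (u₃ - u₂) + (6) * (v₃ - v₂) * (v₃ - v₂) * (u₃ - u₂) * (u₄ - u₃) + (3) * (v₃ - v₂) * (v₃ - v₂) * (u₃ - u₂) * (u₅ - u₄) + (36) * (v₃ - v₂) * (u₂ - v₃) * (u₂ - v₃) * (u₂ - v₃) + (72) * (v₃ - v₂) * (u₂ - v₃) * (u₂ - v₃) * (u₃ - u₂) + (36) * (v₃ - v₂) * (u₂ - v₃) * (u₂ - v₃) * (u₄ - u₃) + (18) * (v₃ - v₂) * (u₂ - v₃) * (u₂ - v₃) * (u₅ - u₄) + (45) * (v₃ - v₂) * (u₂ - v₃) * (u₃ - u₂) * (u₃ - u₂) + (42) * (v₃ - v₂) * (u₂ - v₃)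 * (u₃ - u₂) * (u₄ - u₃) + (21) * (v₃ - v₂) * (u₂ - v₃) * (u₃ - u₂) * (u₅ - u₄) + (6) * (v₃ - v₂) * (u₂ - v₃) * (u₄ - u₃) * (u₄ - u₃) + (6) * (v₃ - v₂) * (u₂ - v₃) * (u₄ - u₃) * (u₅ - u₄) + (9) * (v₃ - v₂) * (u₃ - u₂) * (u₃ - u₂) * (u₃ - u₂) + (12) * (v₃ - v₂) * (u₃ - u₂) * (u₃ - u₂) * (u₄ - u₃) + (6) * (v₃ - v₂) * (u₃ - u₂) * (u₃ - u₂) * (u₅ - u₄) + (3) * (v₃ - v₂) * (u₃ - u₂) * (u₄ - u₃) * (u₄ - u₃) + (3) * (v₃ - v₂) * (u₃ - u₂) * (u₄ - u₃) * (u₅ - u₄) + (12) * (u₂ - v₃) * (u₂ - v₃) * (u₂ - v₃) * (u₂ - v₃) + (30) * (u₂ - v₃) * (u₂ - v₃) * (u₂ - v₃) * (u₃ - u₂) + (12) * (u₂ - v₃) * (u₂ - v₃) * (u₂ - v₃) * (u₄ - u₃) + (6) * (u₂ - v₃) * (u₂ - v₃) * (u₂ - v₃) * (u₅ - u₄) +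 (27) * (u₂ - v₃) * (u₂ - v₃) * (u₃ - u₂) * (u₃ - u₂) + (18) * (u₂ - v₃) * (u₂ - v₃) * (u₃ - u₂) * (u₄ - u₃) + (9) * (u₂ - v₃) * (u₂ - v₃) * (u₃ - u₂) * (u₅ - u₄) + (12) * (u₂ - v₃) * (u₃ - u₂) * (u₃ - u₂) * (u₃ - u₂) + (12) * (u₂ - v₃) * (u₃ - u₂) * (u₃ - u₂) * (u₄ - u₃) + (6) * (u₂ - v₃) * (u₃ - u₂) * (u₃ - u₂) * (u₅ - u₄) + (3) * (u₃ - u₂) * (u₃ - u₂) * (u₃ - u₂) * (u₃ - u₂) + (6) * (u₃ - u₂) * (u₃ - u₂) * (u₃ - u₂) * (u₄ - u₃) + (3) * (u₃ - u₂) * (u₃ - u₂) * (u₃ - u₂) * (u₅ - u₄) + (3) * (u₃ - u₂) * (u₃ - u₂) * (u₄ - u₃) * (u₄ - u₃) + (3) * (u₃ - u₂) * (u₃ - u₂) * (u₄ - u₃) * (u₅ - u₄))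
        + ((2) * (v₁ - u₁) + (-6) * (v₃ - v₂) + (-10) * (u₂ - v₃) + (-7) * (u₃ - u₂) + (-4) * (u₄ - u₃) + (-2) * (u₅ - u₄)) * ((u₁ ^ 3 + u₂ ^ 3 + u₃ ^ 3 + u₄ ^ 3 + u₅ ^ 3) - (v₁ ^ 3 + v₂ ^ 3 + v₃ ^ 3)) := by
    have hv : v₃ = u₁ + u₂ + u₃ + u₄ + u₅ - v₁ - v₂ := by linarith
    subst hv
    ring
  rw [key, hP4, mul_zero, add_zero]
  positivity

/-- REAL CONJECTURE N (every `λ ≥ 0`) ON THE SORTED PATTERN (1,1,1): `Q₄ ≥ 0` there, then pv2-g15's `conjectureN_53_of_Q4_nonneg`. -/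
theorem Glam_nonneg_111 (A₁ A₂ A₃ A₄ A₅ B₁ B₂ B₃ u₁ u₂ u₃ u₄ u₅ v₁ v₂ v₃ : ℝ)
    (hA : A₁ + A₂ + A₃ + A₄ + A₅ = B₁ + B₂ + B₃) (hC : u₁ + u₂ + u₃ + u₄ + u₅ = v₁ + v₂ + v₃)
    (hP1 : (A₁ ^ 2 * u₁ + A₂ ^ 2 * u₂ + A₃ ^ 2 * u₃ + A₄ ^ 2 * u₄ + A₅ ^ 2 * u₅) - (B₁ ^ 2 * v₁ + B₂ ^ 2 * v₂ + B₃ ^ 2 * v₃) = 0)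
    (hP2 : (A₁ * u₁ ^ 2 + A₂ * u₂ ^ 2 + A₃ * u₃ ^ 2 + A₄ * u₄ ^ 2 + A₅ * u₅ ^ 2) - (B₁ * v₁ ^ 2 + B₂ * v₂ ^ 2 + B₃ * v₃ ^ 2) = 0)
    (hP4 : (u₁ ^ 3 + u₂ ^ 3 + u₃ ^ 3 + u₄ ^ 3 + u₅ ^ 3) - (v₁ ^ 3 + v₂ ^ 3 + v₃ ^ 3) = 0)
    (m₁₁ : |u₁ - v₁| ≤ A₁ - B₁) (m₂₁ : |u₂ - v₁| ≤ A₂ - B₁) (m₃₁ : |u₃ - v₁| ≤ A₃ - B₁) (m₄₁ : |u₄ - v₁| ≤ A₄ - B₁) (m₅₁ : |u₅ - v₁| ≤ A₅ - B₁)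
    (m₁₂ : |u₁ - v₂| ≤ A₁ - B₂) (m₂₂ : |u₂ - v₂| ≤ A₂ - B₂) (m₃₂ : |u₃ - v₂| ≤ A₃ - B₂) (m₄₂ : |u₄ - v₂| ≤ A₄ - B₂) (m₅₂ : |u₅ - v₂| ≤ A₅ - B₂)
    (m₁₃ : |u₁ - v₃| ≤ A₁ - B₃) (m₂₃ : |u₂ - v₃| ≤ A₂ - B₃) (m₃₃ : |u₃ - v₃| ≤ A₃ - B₃) (m₄₃ : |u₄ - v₃| ≤ A₄ - B₃) (m₅₃ : |u₅ - v₃| ≤ A₅ - B₃)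
    (h₀ : u₁ ≤ v₁) (h₁ : v₁ ≤ v₂) (h₂ : v₂ ≤ v₃) (h₃ : v₃ ≤ u₂) (h₄ : u₂ ≤ u₃) (h₅ : u₃ ≤ u₄) (h₆ : u₄ ≤ u₅)
    (l : ℝ) (hl : 0 ≤ l) :
    0 ≤ (1 / 2) * ((A₁ ^ 2 + A₂ ^ 2 + A₃ ^ 2 + A₄ ^ 2 + A₅ ^ 2) - (B₁ ^ 2 + B₂ ^ 2 + B₃ ^ 2)) * ((u₁ ^ 2 + u₂ ^ 2 + u₃ ^ 2 + u₄ ^ 2 + u₅ ^ 2) - (v₁ ^ 2 + v₂ ^ 2 + v₃ ^ 2))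
        + ((A₁ * u₁ + A₂ * u₂ + A₃ * u₃ + A₄ * u₄ + A₅ * u₅) - (B₁ * v₁ + B₂ * v₂ + B₃ * v₃)) ^ 2
        - 3 * ((A₁ ^ 2 * u₁ ^ 2 + A₂ ^ 2 * u₂ ^ 2 + A₃ ^ 2 * u₃ ^ 2 + A₄ ^ 2 * u₄ ^ 2 + A₅ ^ 2 * u₅ ^ 2) - (B₁ ^ 2 * v₁ ^ 2 + B₂ ^ 2 * v₂ ^ 2 + B₃ ^ 2 * v₃ ^ 2))
      + l * (3 * ((u₁ ^ 4 + u₂ ^ 4 + u₃ ^ 4 + u₄ ^ 4 + u₅ ^ 4) - (v₁ ^ 4 + v₂ ^ 4 + v₃ ^ 4)) - (3 / 2) * ((u₁ ^ 2 + u₂ ^ 2 + u₃ ^ 2 + u₄ ^ 2 + u₅ ^ 2) - (v₁ ^ 2 + v₂ ^ 2 + v₃ ^ 2)) ^ 2) :=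
  conjectureN_53_of_Q4_nonneg A₁ A₂ A₃ A₄ A₅ B₁ B₂ B₃ u₁ u₂ u₃ u₄ u₅ v₁ v₂ v₃ hA hC hP1 hP2 m₁₁ m₂₁ m₃₁ m₄₁ m₅₁ m₁₂ m₂₂ m₃₂ m₄₂ m₅₂ m₁₃ m₂₃ m₃₃ m₄₃ m₅₃
    (Q4_nonneg_111 u₁ u₂ u₃ u₄ u₅ v₁ v₂ v₃ hC hP4 h₀ h₁ h₂ h₃ h₄ h₅ h₆) l hl

set_option maxHeartbeats 800000 in
/-- REAL CONJECTURE N (every `λ ≥ 0`) ON THE SORTED PATTERN (4,4,4) (`u₁ ≤ u₂ ≤ u₃ ≤ u₄ ≤ v₁ ≤ v₂ ≤ v₃ ≤ u₅`), by reflection from (1,1,1). -/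
theorem Glam_nonneg_444 (A₁ A₂ A₃ A₄ A₅ B₁ B₂ B₃ u₁ u₂ u₃ u₄ u₅ v₁ v₂ v₃ : ℝ)
    (hA : A₁ + A₂ + A₃ + A₄ + A₅ = B₁ + B₂ + B₃) (hC : u₁ + u₂ + u₃ + u₄ + u₅ = v₁ + v₂ + v₃)
    (hP1 : (A₁ ^ 2 * u₁ + A₂ ^ 2 * u₂ + A₃ ^ 2 * u₃ + A₄ ^ 2 * u₄ + A₅ ^ 2 * u₅) - (B₁ ^ 2 * v₁ + B₂ ^ 2 * v₂ + B₃ ^ 2 * v₃) = 0)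
    (hP2 : (A₁ * u₁ ^ 2 + A₂ * u₂ ^ 2 + A₃ * u₃ ^ 2 + A₄ * u₄ ^ 2 + A₅ * u₅ ^ 2) - (B₁ * v₁ ^ 2 + B₂ * v₂ ^ 2 + B₃ * v₃ ^ 2) = 0)
    (hP4 : (u₁ ^ 3 + u₂ ^ 3 + u₃ ^ 3 + u₄ ^ 3 + u₅ ^ 3) - (v₁ ^ 3 + v₂ ^ 3 + v₃ ^ 3) = 0)
    (m₁₁ : |u₁ - v₁| ≤ A₁ - B₁) (m₂₁ : |u₂ - v₁| ≤ A₂ - B₁) (m₃₁ : |u₃ - v₁| ≤ A₃ - B₁) (m₄₁ : |u₄ - v₁| ≤ A₄ - B₁) (m₅₁ : |u₅ - v₁| ≤ A₅ - B₁)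
    (m₁₂ : |u₁ - v₂| ≤ A₁ - B₂) (m₂₂ : |u₂ - v₂| ≤ A₂ - B₂) (m₃₂ : |u₃ - v₂| ≤ A₃ - B₂) (m₄₂ : |u₄ - v₂| ≤ A₄ - B₂) (m₅₂ : |u₅ - v₂| ≤ A₅ - B₂)
    (m₁₃ : |u₁ - v₃| ≤ A₁ - B₃) (m₂₃ : |u₂ - v₃| ≤ A₂ - B₃) (m₃₃ : |u₃ - v₃| ≤ A₃ - B₃) (m₄₃ : |u₄ - v₃| ≤ A₄ - B₃) (m₅₃ : |u₅ - v₃| ≤ A₅ - B₃)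
    (h₀ : u₁ ≤ u₂) (h₁ : u₂ ≤ u₃) (h₂ : u₃ ≤ u₄) (h₃ : u₄ ≤ v₁) (h₄ : v₁ ≤ v₂) (h₅ : v₂ ≤ v₃) (h₆ : v₃ ≤ u₅)
    (l : ℝ) (hl : 0 ≤ l) :
    0 ≤ (1 / 2) * ((A₁ ^ 2 + A₂ ^ 2 + A₃ ^ 2 + A₄ ^ 2 + A₅ ^ 2) - (B₁ ^ 2 + B₂ ^ 2 + B₃ ^ 2)) * ((u₁ ^ 2 + u₂ ^ 2 + u₃ ^ 2 + u₄ ^ 2 + u₅ ^ 2) - (v₁ ^ 2 + v₂ ^ 2 + v₃ ^ 2))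
        + ((A₁ * u₁ + A₂ * u₂ + A₃ * u₃ + A₄ * u₄ + A₅ * u₅) - (B₁ * v₁ + B₂ * v₂ + B₃ * v₃)) ^ 2
        - 3 * ((A₁ ^ 2 * u₁ ^ 2 + A₂ ^ 2 * u₂ ^ 2 + A₃ ^ 2 * u₃ ^ 2 + A₄ ^ 2 * u₄ ^ 2 + A₅ ^ 2 * u₅ ^ 2) - (B₁ ^ 2 * v₁ ^ 2 + B₂ ^ 2 * v₂ ^ 2 + B₃ ^ 2 * v₃ ^ 2))
      + l * (3 * ((u₁ ^ 4 + u₂ ^ 4 + u₃ ^ 4 + u₄ ^ 4 + u₅ ^ 4) - (v₁ ^ 4 + v₂ ^ 4 + v₃ ^ 4)) - (3 / 2) * ((u₁ ^ 2 + u₂ ^ 2 + u₃ ^ 2 + u₄ ^ 2 + u₅ ^ 2) - (v₁ ^ 2 + v₂ ^ 2 + v₃ ^ 2)) ^ 2) := by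
  have key := Glam_nonneg_111 A₅ A₄ A₃ A₂ A₁ B₃ B₂ B₁ (-u₅) (-u₄) (-u₃) (-u₂) (-u₁) (-v₃) (-v₂) (-v₁)
      (by linarith) (by linarith) (by linear_combination (-1 : ℝ) * hP1) (by linear_combination hP2)
      (by linear_combination (-1 : ℝ) * hP4)
      (by rw [show (-u₅) - (-v₃) = -(u₅ - v₃) by ring, abs_neg]; exact m₅₃)
      (by rw [show (-u₄) - (-v₃) = -(u₄ - v₃) by ring, abs_neg]; exact m₄₃)
      (by rw [show (-u₃) - (-v₃) = -(u₃ - v₃) by ring, abs_neg]; exact m₃₃)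
      (by rw [show (-u₂) - (-v₃) = -(u₂ - v₃) by ring, abs_neg]; exact m₂₃)
      (by rw [show (-u₁) - (-v₃) = -(u₁ - v₃) by ring, abs_neg]; exact m₁₃)
      (by rw [show (-u₅) - (-v₂) = -(u₅ - v₂) by ring, abs_neg]; exact m₅₂)
      (by rw [show (-u₄) - (-v₂) = -(u₄ - v₂) by ring, abs_neg]; exact m₄₂)
      (by rw [show (-u₃) - (-v₂) = -(u₃ - v₂) by ring, abs_neg]; exact m₃₂)
      (by rw [show (-u₂) - (-v₂) = -(u₂ - v₂) by ring, abs_neg]; exact m₂₂)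
      (by rw [show (-u₁) - (-v₂) = -(u₁ - v₂) by ring, abs_neg]; exact m₁₂)
      (by rw [show (-u₅) - (-v₁) = -(u₅ - v₁) by ring, abs_neg]; exact m₅₁)
      (by rw [show (-u₄) - (-v₁) = -(u₄ - v₁) by ring, abs_neg]; exact m₄₁)
      (by rw [show (-u₃) - (-v₁) = -(u₃ - v₁) by ring, abs_neg]; exact m₃₁)
      (by rw [show (-u₂) - (-v₁) = -(u₂ - v₁) by ring, abs_neg]; exact m₂₁)
      (by rw [show (-u₁) - (-v₁) = -(u₁ - v₁) by ring, abs_neg]; exact m₁₁)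
      (by linarith) (by linarith) (by linarith) (by linarith) (by linarith) (by linarith) (by linarith) l hl
  have e : (1 / 2) * ((A₁ ^ 2 + A₂ ^ 2 + A₃ ^ 2 + A₄ ^ 2 + A₅ ^ 2) - (B₁ ^ 2 + B₂ ^ 2 + B₃ ^ 2)) * ((u₁ ^ 2 + u₂ ^ 2 + u₃ ^ 2 + u₄ ^ 2 + u₅ ^ 2) - (v₁ ^ 2 + v₂ ^ 2 + v₃ ^ 2))
        + ((A₁ * u₁ + A₂ * u₂ + A₃ * u₃ + A₄ * u₄ + A₅ * u₅) - (B₁ * v₁ + B₂ * v₂ + B₃ * v₃)) ^ 2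
        - 3 * ((A₁ ^ 2 * u₁ ^ 2 + A₂ ^ 2 * u₂ ^ 2 + A₃ ^ 2 * u₃ ^ 2 + A₄ ^ 2 * u₄ ^ 2 + A₅ ^ 2 * u₅ ^ 2) - (B₁ ^ 2 * v₁ ^ 2 + B₂ ^ 2 * v₂ ^ 2 + B₃ ^ 2 * v₃ ^ 2))
      + l * (3 * ((u₁ ^ 4 + u₂ ^ 4 + u₃ ^ 4 + u₄ ^ 4 + u₅ ^ 4) - (v₁ ^ 4 + v₂ ^ 4 + v₃ ^ 4)) - (3 / 2) * ((u₁ ^ 2 + u₂ ^ 2 + u₃ ^ 2 + u₄ ^ 2 + u₅ ^ 2) - (v₁ ^ 2 + v₂ ^ 2 + v₃ ^ 2)) ^ 2)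
      = (1 / 2) * ((A₅ ^ 2 + A₄ ^ 2 + A₃ ^ 2 + A₂ ^ 2 + A₁ ^ 2) - (B₃ ^ 2 + B₂ ^ 2 + B₁ ^ 2)) * (((-u₅) ^ 2 + (-u₄) ^ 2 + (-u₃) ^ 2 + (-u₂) ^ 2 + (-u₁) ^ 2) - ((-v₃) ^ 2 + (-v₂) ^ 2 + (-v₁) ^ 2))
        + ((A₅ * (-u₅) + A₄ * (-u₄) + A₃ * (-u₃) + A₂ * (-u₂) + A₁ * (-u₁)) - (B₃ * (-v₃) + B₂ * (-v₂) + B₁ * (-v₁))) ^ 2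
        - 3 * ((A₅ ^ 2 * (-u₅) ^ 2 + A₄ ^ 2 * (-u₄) ^ 2 + A₃ ^ 2 * (-u₃) ^ 2 + A₂ ^ 2 * (-u₂) ^ 2 + A₁ ^ 2 * (-u₁) ^ 2) - (B₃ ^ 2 * (-v₃) ^ 2 + B₂ ^ 2 * (-v₂) ^ 2 + B₁ ^ 2 * (-v₁) ^ 2))
      + l * (3 * (((-u₅) ^ 4 + (-u₄) ^ 4 + (-u₃) ^ 4 + (-u₂) ^ 4 + (-u₁) ^ 4) - ((-v₃) ^ 4 + (-v₂) ^ 4 + (-v₁) ^ 4)) - (3 / 2) * (((-u₅) ^ 2 + (-u₄) ^ 2 + (-u₃) ^ 2 + (-u₂) ^ 2 + (-u₁) ^ 2) - ((-v₃) ^ 2 + (-v₂) ^ 2 + (-v₁) ^ 2)) ^ 2) := by ring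
  rw [e]; exact key

end Summit.HodgeConjecture.HodgeConjecture.WeilClassTestFormatFiveThreePattern111
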